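import Summits.CriticalPhenomena.PercolationContinuityZ3.Theorems.PercNearOneGluingNoHeavyLowerTailKnQuestion8CoefficientwiseContraction
import HarnessLib

/-!
# Root contraction for TARGET SETS: the NC* sum of `G/e` and the reduction 'RCW + root-star base case ⟹ CONJECTURE NC*' — prim-lf-2 gen 65

Support file (`--supports stmt-CriticalPhenomena-4575`, closed), prover `prim-lf-2` (gen 65).  No definitions, no named facts, no sorries; standard axioms.
Memo `prim-lf-2/CW-NCDOWN-gen65.md` §6; the single-target version is gen 56's `…CoefficientwiseContraction.lean` (`noCore_contract_eq`, `noCore_of_rootContraction`).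

Setting: finite multigraph `ends : ι → Sym2 V`, edge set `E`, root `x`, target SET `W`; `C_x(s) = openCluster (ends '' s) x`;
`NC*_E(x,W)[f,g] := Σ_{s ⊆ E : ∀ w ∈ W, ¬(w ∈ C_x(s) ∧ w ∈ C_x(E∖s))} (f(C_x s) − f(C_x(E∖s)))(g(C_x s) − g(C_x(E∖s)))` (CONJECTURE NC*, prim-lf-2 gen 63: `≥ 0`).
For a root edge `e = {x,p}` (`p ≠ x`, `p ∉ W`) the contraction `G/e` is `Sym2.map (update id p x) ∘ ends` on `E.erase e` (gen 56).
* `Coefficientwise.ncStar_contract_eq` — the NC* sum of `G/e` (target set `W ∌ p`, functions `X ↦ f(insert p X)`) equals the 'doubly open' sum on `G`: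
  `Σ_{s ⊆ E∖e : ∀ w∈W, ¬(w ∈ C_x(s+e) ∧ w ∈ C_x(E∖s))} (f(C_x(s+e)) − f(C_x(E∖s)))(g(C_x(s+e)) − g(C_x(E∖s)))`.
* `Coefficientwise.ncStar_of_rootContractionW` — **REDUCTION.**  If (RCW) `NC*_E(x,W) ≥` that doubly-open sum for every multigraph, every root edge `e = {x,p}` with `p ∉ W ∪ {x}`,
  every `W ∌ x` and all monotone `f, g`, AND (BASE) `NC*_E(x,W) ≥ 0` whenever every edge at `x` is a loop or ends in `W`, then CONJECTURE NC* holds for every multigraph on `ι, V`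
  and every `W ∌ x`.  (Induction on `|E|`: contract a root edge missing `W`.)
Census for RCW (prim-lf-2 gen 65, rc.c, exact over all monotone pairs): every root edge of every rooted connected graph on ≤ 6 vertices × every `W ∌ x, p` (1 001 + 17 100 cases):
0 failures; n = 7 partial (2 883 cases) 0 failures; n = 7 complete and n = 8 2-connected: kit65u (see memo).  RC/RCW is the one structured strengthening of NC* not refuted at
n ≤ 8 by gen 65's censuses (NC-DOWN fails at n = 8, dominating matchings at n = 9).
[cite: KozmaNitzan2024, Questions 8–9 (§5.5 p. 36) (context: the Question-8 pocket covariance programme)]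
-/

namespace Summit.CriticalPhenomena.PercolationContinuityZ3.Theorems

open Finset Literature.Probability.Percolation

namespace Coefficientwise

variable {ι V : Type*} [DecidableEq ι] [DecidableEq V]

open Classical in
/-- **The NC* sum of a root contraction.**  For `e ∈ E` with ends `{x,p}`, `p ≠ x`, and a target set `W ∌ p`:
the NC* sum of `G/e` for `W` and the functions `X ↦ f(insert p X)`, `X ↦ g(insert p X)` equals the doubly-open sum on `G`.
[cite: KozmaNitzan2024, Questions 8–9 (§5.5 p. 36) (context)] -/
theorem ncStar_contract_eq (ends : ι → Sym2 V) (E : Finset ι) {e : ι} (he : e ∈ E) {x p : V} (W : Set V)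
    (hxp : ends e = s(x, p)) (hpx : p ≠ x) (hpW : p ∉ W) (f g : Set V → ℝ) :
    (∑ s ∈ (E.erase e).powerset.filter (fun s : Finset ι =>
        ∀ w ∈ W, ¬ (w ∈ openCluster ((fun i => Sym2.map (Function.update id p x) (ends i)) '' (↑s : Set ι)) x ∧
           w ∈ openCluster ((fun i => Sym2.map (Function.update id p x) (ends i)) '' (↑(E.erase e \ s) : Set ι)) x)),
      (f (insert p (openCluster ((fun i => Sym2.map (Function.update id p x) (ends i)) '' (↑s : Set ι)) x)) -
          f (insert p (openCluster ((fun i => Sym2.map (Function.update id p x) (ends i)) '' (↑(E.erase e \ s) : Set ι)) x))) *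
        (g (insert p (openCluster ((fun i => Sym2.map (Function.update id p x) (ends i)) '' (↑s : Set ι)) x)) -
          g (insert p (openCluster ((fun i => Sym2.map (Function.update id p x) (ends i)) '' (↑(E.erase e \ s) : Set ι)) x)))) =
    ∑ s ∈ (E.erase e).powerset.filter (fun s : Finset ι =>
        ∀ w ∈ W, ¬ (w ∈ openCluster (ends '' (↑(insert e s) : Set ι)) x ∧ w ∈ openCluster (ends '' (↑(E \ s) : Set ι)) x)),
      (f (openCluster (ends '' (↑(insert e s) : Set ι)) x) - f (openCluster (ends '' (↑(E \ s) : Set ι)) x)) *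
        (g (openCluster (ends '' (↑(insert e s) : Set ι)) x) - g (openCluster (ends '' (↑(E \ s) : Set ι)) x)) := by
  set ends' : ι → Sym2 V := fun i => Sym2.map (Function.update id p x) (ends i) with hends'
  set K' : Finset ι → Set V := fun s => openCluster (ends' '' (↑s : Set ι)) x with hK'
  set K : Finset ι → Set V := fun s => openCluster (ends '' (↑s : Set ι)) x with hK
  have hins : ∀ s : Finset ι, insert p (K' s) = K (insert e s) := fun s => openCluster_contract_insert ends s hxp hpx
  have hmem : ∀ s : Finset ι, ∀ w ∈ W, (w ∈ K' s ↔ w ∈ K (insert e s)) := fun s w hw => by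
    have hwp : w ≠ p := fun h => hpW (h ▸ hw)
    rw [hK', mem_openCluster_contract_iff ends s hxp hpx w]; exact ⟨fun h => h.2, fun h => ⟨hwp, h⟩⟩
  have hcomp : ∀ s ∈ (E.erase e).powerset, insert e (E.erase e \ s) = E \ s := fun s hs =>
    insert_erase_sdiff he (Finset.mem_powerset.mp hs)
  rw [Finset.sum_filter, Finset.sum_filter]
  refine Finset.sum_congr rfl fun s hs => ?_
  have hs' : E.erase e \ s ∈ (E.erase e).powerset := Finset.mem_powerset.mpr Finset.sdiff_subset
  have e1 : insert p (K' s) = K (insert e s) := hins s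
  have e2 : insert p (K' (E.erase e \ s)) = K (E \ s) := by rw [hins, hcomp s hs]
  have m : (∀ w ∈ W, ¬ (w ∈ K' s ∧ w ∈ K' (E.erase e \ s))) ↔ (∀ w ∈ W, ¬ (w ∈ K (insert e s) ∧ w ∈ K (E \ s))) := by
    refine forall₂_congr fun w hw => not_congr (and_congr (hmem s w hw) ?_)
    rw [hmem (E.erase e \ s) w hw, hcomp s hs]
  change (if (∀ w ∈ W, ¬ (w ∈ K' s ∧ w ∈ K' (E.erase e \ s))) then
      (f (insert p (K' s)) - f (insert p (K' (E.erase e \ s)))) * (g (insert p (K' s)) - g (insert p (K' (E.erase e \ s)))) else 0) =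
    (if (∀ w ∈ W, ¬ (w ∈ K (insert e s) ∧ w ∈ K (E \ s))) then
      (f (K (insert e s)) - f (K (E \ s))) * (g (K (insert e s)) - g (K (E \ s))) else 0)
  rw [e1, e2]
  exact if_congr m rfl rfl

open Classical in
/-- **REDUCTION: RCW + the root-star base case ⟹ NC*.**  Suppose (RCW) for every multigraph `ends`, edge set `E`, root edge `e ∈ E` with ends `{x,p}`, `p ≠ x`, every target set `W`
with `x ∉ W`, `p ∉ W`, and all monotone `f, g`, the doubly-open sum is at most `NC*_E(x,W)[f,g]`; and (BASE) `NC*_E(x,W)[f,g] ≥ 0` whenever every edge of `E` at `x` is a loop or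
has its other end in `W`.  Then `0 ≤ NC*_E(x,W)[f,g]` for every multigraph on `ι, V`, every `W ∌ x` and all monotone `f, g`.
[cite: KozmaNitzan2024, Questions 8–9 (§5.5 p. 36) (context)] -/
theorem ncStar_of_rootContractionW
    (hRCW : ∀ (ends : ι → Sym2 V) (E : Finset ι) (e : ι), e ∈ E → ∀ (x p : V) (W : Set V), ends e = s(x, p) → p ≠ x → x ∉ W → p ∉ W →
      ∀ (f g : Set V → ℝ), Monotone f → Monotone g →
      (∑ s ∈ (E.erase e).powerset.filter (fun s : Finset ι =>
          ∀ w ∈ W, ¬ (w ∈ openCluster (ends '' (↑(insert e s) : Set ι)) x ∧ w ∈ openCluster (ends '' (↑(E \ s) : Set ι)) x)),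
        (f (openCluster (ends '' (↑(insert e s) : Set ι)) x) - f (openCluster (ends '' (↑(E \ s) : Set ι)) x)) *
          (g (openCluster (ends '' (↑(insert e s) : Set ι)) x) - g (openCluster (ends '' (↑(E \ s) : Set ι)) x))) ≤
      ∑ s ∈ E.powerset.filter (fun s : Finset ι =>
            ∀ w ∈ W, ¬ (w ∈ openCluster (ends '' (↑s : Set ι)) x ∧ w ∈ openCluster (ends '' (↑(E \ s) : Set ι)) x)),
        (f (openCluster (ends '' (↑s : Set ι)) x) - f (openCluster (ends '' (↑(E \ s) : Set ι)) x)) *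
          (g (openCluster (ends '' (↑s : Set ι)) x) - g (openCluster (ends '' (↑(E \ s) : Set ι)) x)))
    (hBASE : ∀ (ends : ι → Sym2 V) (E : Finset ι) (x : V) (W : Set V), x ∉ W →
      (∀ e ∈ E, ∀ p : V, ends e = s(x, p) → p ≠ x → p ∈ W) →
      ∀ (f g : Set V → ℝ), Monotone f → Monotone g →
      0 ≤ ∑ s ∈ E.powerset.filter (fun s : Finset ι =>
            ∀ w ∈ W, ¬ (w ∈ openCluster (ends '' (↑s : Set ι)) x ∧ w ∈ openCluster (ends '' (↑(E \ s) : Set ι)) x)),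
        (f (openCluster (ends '' (↑s : Set ι)) x) - f (openCluster (ends '' (↑(E \ s) : Set ι)) x)) *
          (g (openCluster (ends '' (↑s : Set ι)) x) - g (openCluster (ends '' (↑(E \ s) : Set ι)) x)))
    (ends : ι → Sym2 V) (E : Finset ι) (x : V) (W : Set V) (hxW : x ∉ W) (f g : Set V → ℝ) (hf : Monotone f) (hg : Monotone g) :
    0 ≤ ∑ s ∈ E.powerset.filter (fun s : Finset ι =>
          ∀ w ∈ W, ¬ (w ∈ openCluster (ends '' (↑s : Set ι)) x ∧ w ∈ openCluster (ends '' (↑(E \ s) : Set ι)) x)),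
      (f (openCluster (ends '' (↑s : Set ι)) x) - f (openCluster (ends '' (↑(E \ s) : Set ι)) x)) *
        (g (openCluster (ends '' (↑s : Set ι)) x) - g (openCluster (ends '' (↑(E \ s) : Set ι)) x)) := by
  induction hn : E.card using Nat.strong_induction_on generalizing E ends f g with
  | _ n ih =>
  by_cases hroot : ∃ e ∈ E, ∃ p : V, p ≠ x ∧ p ∉ W ∧ ends e = s(x, p)
  · -- a root edge missing `W`: contract it
    obtain ⟨e, he, p, hpx, hpW, hxp⟩ := hroot
    refine le_trans ?_ (hRCW ends E e he x p W hxp hpx hxW hpW f g hf hg)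
    rw [← ncStar_contract_eq ends E he W hxp hpx hpW f g]
    have hcard : (E.erase e).card < n := by rw [← hn]; exact Finset.card_erase_lt_of_mem he
    have hf' : Monotone (fun X : Set V => f (insert p X)) := fun X Y hXY => hf (Set.insert_subset_insert hXY)
    have hg' : Monotone (fun X : Set V => g (insert p X)) := fun X Y hXY => hg (Set.insert_subset_insert hXY)
    exact ih _ hcard (fun i => Sym2.map (Function.update id p x) (ends i)) (E.erase e)
      (fun X => f (insert p X)) (fun X => g (insert p X)) hf' hg' rfl
  · -- every edge at `x` is a loop or ends in `W`: the base case
    push Not at hroot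
    exact hBASE ends E x W hxW (fun e he p hep hpx => by
      by_contra hpW
      exact hroot e he p hpx hpW hep) f g hf hg

end Coefficientwise

end Summit.CriticalPhenomena.PercolationContinuityZ3.Theorems
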